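import Mathlib.Algebra.Order.BigOperators.Group.List
import Literature.Computability.Complexity.CircuitLightCone

/-!
# Route KarlinRubin — `MonotoneSuffices` (stmt-PneNP-18026): light cones versus size

A circuit all of whose gates have fan-in `≤ K` reads at most `K · (number of gates) + 1` input
variables: its light cone (`Circuit.lightCone`, `CircuitLightCone.lean`, where only the depth
bound `K ^ depth` is recorded) is contained in the set of inputs wired directly into some gate,
plus possibly the output wire itself. Over `B₂` this is `≤ 2s + 1` for `s` gates
(`circuit_card_lightCone_le_of_isOver_B2`), the combinatorial half of the locality barrier for
stmt-PneNP-18026 (`KarlinRubinMonotoneSufficesLocality.lean`). Helpers (`--supports`).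
-/

set_option linter.dupNamespace false -- `Summit.PneNP.PneNP.…`: summit = sub-problem name (D-0017 single-conjunct layout)

namespace Summit.PneNP.PneNP.Theorems

open Finset Literature.Computability.Complexity Literature.Computability.Complexity.GateList

variable {ι : Type*}

/-- Every input variable in the dependency set of a gate of a straight-line program is read
directly by some gate of the program. [folklore] -/
theorem gateList_exists_args_eq_inl_of_mem_deps [DecidableEq ι] (gs : List (Gate ι)) :
    ∀ (m : ℕ) (i : ι), i ∈ (deps gs).getD m ∅ → ∃ g ∈ gs, ∃ a : Fin g.arity, g.args a = Sum.inl i := by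
  induction gs using List.reverseRecOn with
  | nil => intro m i hi; simp [deps] at hi
  | append_singleton gs g ih =>
    intro m i hi
    rw [deps_append_singleton] at hi
    rcases lt_or_ge m gs.length with hm | hm
    · rw [List.getD_append _ _ _ _ (by simpa using hm)] at hi
      obtain ⟨g', hg', a, ha⟩ := ih m i hi
      exact ⟨g', List.mem_append_left _ hg', a, ha⟩
    · rw [List.getD_append_right _ _ _ _ (by simpa using hm)] at hi
      rcases Nat.lt_or_ge (m - gs.length) 1 with h1 | h1
      · have h0 : m - (deps gs).length = 0 := by simp; omega
        rw [h0] at hi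
        simp only [List.getD_cons_zero] at hi
        unfold depOf at hi
        rw [Finset.mem_biUnion] at hi
        obtain ⟨a, -, ha⟩ := hi
        cases hga : g.args a with
        | inl j =>
          rw [hga] at ha
          simp only [Finset.mem_singleton] at ha
          subst ha
          exact ⟨g, List.mem_append_right _ (List.mem_singleton_self g), a, hga⟩
        | inr m' =>
          rw [hga] at ha
          obtain ⟨g', hg', a', ha'⟩ := ih m' i ha
          exact ⟨g', List.mem_append_left _ hg', a', ha'⟩
      · obtain ⟨j, hj⟩ : ∃ j, m - (deps gs).length = j + 1 := ⟨m - (deps gs).length - 1, by simp; omega⟩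
        rw [hj] at hi
        simp at hi

/-- The input variables read directly by the gates of a program number at most the total fan-in.
[folklore] -/
theorem gateList_card_filter_read_le [Fintype ι] [DecidableEq ι] (gs : List (Gate ι)) :
    (univ.filter fun i : ι => ∃ g ∈ gs, ∃ a : Fin g.arity, g.args a = Sum.inl i).card ≤
      (gs.map Gate.arity).sum := by
  induction gs with
  | nil => simp
  | cons g gs ih =>
    have hsplit : (univ.filter fun i : ι => ∃ g' ∈ g :: gs, ∃ a : Fin g'.arity, g'.args a = Sum.inl i)
        ⊆ (univ.filter fun i : ι => ∃ a : Fin g.arity, g.args a = Sum.inl i) ∪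
          (univ.filter fun i : ι => ∃ g' ∈ gs, ∃ a : Fin g'.arity, g'.args a = Sum.inl i) := by
      intro i hi
      simp only [Finset.mem_filter, Finset.mem_univ, true_and, List.mem_cons] at hi
      obtain ⟨g', hg', a, ha⟩ := hi
      rcases hg' with rfl | hg'
      · exact Finset.mem_union_left _ (by simp only [Finset.mem_filter, Finset.mem_univ, true_and]; exact ⟨a, ha⟩)
      · exact Finset.mem_union_right _ (by
          simp only [Finset.mem_filter, Finset.mem_univ, true_and]; exact ⟨g', hg', a, ha⟩)
    have hone : (univ.filter fun i : ι => ∃ a : Fin g.arity, g.args a = Sum.inl i).card ≤ g.arity := by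
      have himg : ((univ.filter fun i : ι => ∃ a : Fin g.arity, g.args a = Sum.inl i).image
          (Sum.inl : ι → ι ⊕ ℕ)) ⊆ (univ : Finset (Fin g.arity)).image g.args := by
        intro w hw
        simp only [Finset.mem_image, Finset.mem_filter, Finset.mem_univ, true_and] at hw ⊢
        obtain ⟨i, ⟨a, ha⟩, rfl⟩ := hw
        exact ⟨a, ha⟩
      calc (univ.filter fun i : ι => ∃ a : Fin g.arity, g.args a = Sum.inl i).card
          = ((univ.filter fun i : ι => ∃ a : Fin g.arity, g.args a = Sum.inl i).image
              (Sum.inl : ι → ι ⊕ ℕ)).card :=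
            (Finset.card_image_of_injective _ Sum.inl_injective).symm
        _ ≤ ((univ : Finset (Fin g.arity)).image g.args).card := Finset.card_le_card himg
        _ ≤ (univ : Finset (Fin g.arity)).card := Finset.card_image_le
        _ = g.arity := by simp
    calc (univ.filter fun i : ι => ∃ g' ∈ g :: gs, ∃ a : Fin g'.arity, g'.args a = Sum.inl i).card
        ≤ ((univ.filter fun i : ι => ∃ a : Fin g.arity, g.args a = Sum.inl i) ∪
            (univ.filter fun i : ι => ∃ g' ∈ gs, ∃ a : Fin g'.arity, g'.args a = Sum.inl i)).card :=
          Finset.card_le_card hsplit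
      _ ≤ (univ.filter fun i : ι => ∃ a : Fin g.arity, g.args a = Sum.inl i).card +
            (univ.filter fun i : ι => ∃ g' ∈ gs, ∃ a : Fin g'.arity, g'.args a = Sum.inl i).card :=
          Finset.card_union_le _ _
      _ ≤ g.arity + (gs.map Gate.arity).sum := Nat.add_le_add hone ih
      _ = ((g :: gs).map Gate.arity).sum := by simp


/-- **Light cones are no larger than the total fan-in.** If every gate of `C` has fan-in `≤ K`,
the output of `C` depends on at most `K · |C| + 1` input variables (the `+ 1` covers a gate-free
circuit whose output wire is an input). [folklore] -/
theorem circuit_card_lightCone_le_mul_size_succ [Fintype ι] [DecidableEq ι] (C : Circuit ι) {K : ℕ}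
    (hC : ∀ g ∈ C.gates, g.arity ≤ K) : C.lightCone.card ≤ K * C.size + 1 := by
  unfold Circuit.lightCone
  cases C.output with
  | inl i => simp
  | inr m =>
    simp only
    calc ((GateList.deps C.gates).getD m ∅).card
        ≤ (univ.filter fun i : ι => ∃ g ∈ C.gates, ∃ a : Fin g.arity, g.args a = Sum.inl i).card := by
          refine Finset.card_le_card fun i hi => ?_
          simp only [Finset.mem_filter, Finset.mem_univ, true_and]
          exact gateList_exists_args_eq_inl_of_mem_deps C.gates m i hi
      _ ≤ (C.gates.map Gate.arity).sum := gateList_card_filter_read_le C.gates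
      _ ≤ K * C.size := by
          have h := List.sum_le_card_nsmul (C.gates.map Gate.arity) K (by
            intro x hx
            rw [List.mem_map] at hx
            obtain ⟨g, hg, rfl⟩ := hx
            exact hC g hg)
          simpa [Circuit.size, mul_comm] using h
      _ ≤ K * C.size + 1 := Nat.le_succ _

/-- Over `B₂` (fan-in `≤ 2`) a circuit with `s` gates depends on at most `2s + 1` inputs.
[folklore] -/
theorem circuit_card_lightCone_le_of_isOver_B2 [Fintype ι] [DecidableEq ι] (C : Circuit ι)
    (hC : C.IsOver B2) : C.lightCone.card ≤ 2 * C.size + 1 :=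
  circuit_card_lightCone_le_mul_size_succ C fun g hg => hC g hg

end Summit.PneNP.PneNP.Theorems
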